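import Mathlib
import Literature.NumberTheory.LFunctions.Zhang2022.Section4Statements
import Literature.NumberTheory.LFunctions.Zhang2022.TypedSection04A
import Literature.NumberTheory.LFunctions.Zhang2022.SkeletonAssembly
import HarnessLib

/-!
# Zhang (2022), §4 (4.6): "`(Z̃′/Z̃)(s,ψ) = −2 log P + O(𝓛)`" on the whole printed range
# `|Re(s − s₀)| < 100`, `|Im(s − s₀)| < 𝓛₁ + 3` — the typed node `Section4.Eq46` DISCHARGED

Topic `Literature/NumberTheory/LFunctions/Zhang2022` (Landau–Siegel audit tree; verdict-neutral).
Y. Zhang, *Discrete mean estimates and the Landau–Siegel zero*, arXiv:2211.02515v1 (2022)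
[Zhang2022LandauSiegel] — **an unrefereed manuscript under adjudication; nothing here bears on its
Theorems 1–2.** Source, §4 p. 19 [Z22 p.19, (4.6), tex L1034], after "By (2.4) with `θ = ψ` and
`θ = ψχ` … This yields, by Stirling's formula, (4.5) and":

> `(Z̃′/Z̃)(s,ψ) = −2 log P + O(𝓛)`   (4.6)

for `|Re(s − s₀)| < 100`, `|Im(s − s₀)| < 𝓛₁ + 3` (`Z̃(s,ψ) = Z(s,ψ)Z(s,ψχ)`, `s₀ = ½ + 2πit₀`,
`t₀ = 𝓛⁵¹⁹`, `𝓛₁ = 𝓛⁴⁰⁵`, `P = e^{𝓛⁹}`, `p ∼ P`; DAG node `Z22:(4.6)`, typed as `Section4.Eq46` in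
`Section4Statements.lean` (of record) and as `Typed.Section04A.Eq46` in `TypedSection04A.lean`).

THIS FILE PROVES both typed forms (`Section4.eq46_holds`, `Typed.Section04A.eq46_holds`), theorems
only, no new definition, no new fact. The one point flagged on the campaign board (L1-t3, 23:36Z):
the tree's Stirling bound `GammaFactor.norm_logDeriv_tildeZ_add_log_le` covers `0 < σ ≤ A` only,
while the printed range reaches `σ = ½ − 100 < 0`. The extension is the reflection of the factor
`ϑ` (= the tree's `χ` of the functional equation of `ζ`, `SiegelIntegral.rsChi`, off the real axis):
`ϑ(s)ϑ(1−s) = 1` and `ϑ(s̄) = conj ϑ(s)` give `(ϑ′/ϑ)(σ+it) = conj (ϑ′/ϑ)((1−σ)+it)`, and `1 − σ > 0`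
when `σ ≤ 0` (`GammaFactor.norm_logDeriv_vartheta_add_log_le_of_abs_le`). Then, per factor,
`Z′/Z(s,θ) = −log k + ϑ′/ϑ(s) + E` (`GammaFactor.logDeriv_Zfac_eq`, `|E| ≤ 2/t`) gives
`‖(Z̃′/Z̃)(σ+it) + log(k₁t/2π) + log(k₂t/2π)‖ ≤ 2(2A+7)/t` for `|σ| ≤ A`, `t ≥ 2(A+1)`
(`GammaFactor.norm_logDeriv_tildeZ_add_log_le_of_abs_le`), and the bookkeeping `k₁ = p ∈ (P, 2P)`,
`k₂ = Dp`, `t/2π ∈ (1, 2t₀)`: `log(k₁t/2π) + log(k₂t/2π) − 2 log P ∈ [0, 𝓛 + 1038 log 𝓛 + 4]`, so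
`‖Z̃′/Z̃ + 2 log P‖ ≤ 1047·𝓛` for `𝓛 = log D ≥ 32` (constant `C = 1047`, not optimised; the
manuscript's `O(𝓛)` is in fact `−𝓛 − 1038 log 𝓛 + O(1)`).

## References

* Y. Zhang, arXiv:2211.02515v1 (2022), §4 (4.6) p. 19; (2.4), (2.6)–(2.8).
  [cite: Zhang2022LandauSiegel, §4 (4.6) p. 19]
* H. L. Montgomery, R. C. Vaughan, *Multiplicative Number Theory I* (2007), Ch. 10 (10.35) with
  App. C (C.17) (Stirling for `ϑ′/ϑ`, through the tree's `norm_logDeriv_rsChi_add_log_le`).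
  [cite: MontgomeryVaughan2007, Ch. 10 (10.35)]
* E. C. Titchmarsh, *The Theory of the Riemann Zeta-Function* (1986), §2.1 (2.1.11)
  (`χ(s)χ(1−s) = 1`, the tree's `rsChi_mul_rsChi_one_sub`). [cite: Titchmarsh1986, §2.1 (2.1.11)]
-/

noncomputable section

open Complex Real ComplexConjugate Filter
open scoped Topology

namespace Literature.NumberTheory.LFunctions.Zhang2022

namespace GammaFactor

open SiegelIntegral

/-! ## The reflection of `ϑ′/ϑ` across `σ = ½` -/

/-- Off the real axis, `χ(z) = (χ(1−z))⁻¹` identically near any point (`χ(z)χ(1−z) = 1`).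
[cite: Titchmarsh1986, §2.1 (2.1.11)] -/
private theorem rsChi_eventuallyEq_inv {s : ℂ} (hs : s.im ≠ 0) :
    rsChi =ᶠ[𝓝 s] fun z => (rsChi (1 - z))⁻¹ := by
  have ho : IsOpen {z : ℂ | z.im ≠ 0} := isOpen_ne_fun Complex.continuous_im continuous_const
  filter_upwards [ho.mem_nhds hs] with z hz
  exact eq_inv_of_mul_eq_one_left (rsChi_mul_rsChi_one_sub hz)

/-- Off the real axis, `χ = conj ∘ χ ∘ conj` identically near any point (`χ(z̄) = conj χ(z)`).
[folklore] -/
private theorem rsChi_eventuallyEq_conj_conj {s : ℂ} (hs : s.im ≠ 0) :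
    rsChi =ᶠ[𝓝 s] (conj ∘ rsChi ∘ conj) := by
  have ho : IsOpen {z : ℂ | z.im ≠ 0} := isOpen_ne_fun Complex.continuous_im continuous_const
  filter_upwards [ho.mem_nhds hs] with z hz
  simp only [Function.comp_apply]
  rw [rsChi_conj hz, Complex.conj_conj]

/-- `(χ′/χ)(s) = (χ′/χ)(1 − s)` off the real axis (logarithmic derivative of `χ(s)χ(1−s) = 1`).
[cite: Titchmarsh1986, §2.1 (2.1.11)] -/
theorem logDeriv_rsChi_eq_one_sub {s : ℂ} (hs : s.im ≠ 0) :
    logDeriv rsChi s = logDeriv rsChi (1 - s) := by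
  have hs' : (1 - s).im ≠ 0 := by simpa using hs
  have hne : rsChi (1 - s) ≠ 0 := by
    intro h
    have := rsChi_mul_rsChi_one_sub hs
    rw [h, mul_zero] at this
    exact zero_ne_one this
  have hev := rsChi_eventuallyEq_inv hs
  -- the derivative of `z ↦ χ(1 − z)` at `s`
  set h : ℂ → ℂ := fun z => rsChi (1 - z) with hh
  have hd : HasDerivAt h (-deriv rsChi (1 - s)) s := by
    have h1 : HasDerivAt rsChi (deriv rsChi (1 - s)) (1 - s) :=
      (differentiableAt_rsChi_of_im_ne_zero hs').hasDerivAt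
    exact h1.comp_const_sub 1 s
  have hdinv : HasDerivAt (fun z => (h z)⁻¹) (-(-deriv rsChi (1 - s)) / h s ^ 2) s := hd.inv hne
  rw [logDeriv_apply, logDeriv_apply, hev.deriv_eq, hev.self_of_nhds, hdinv.deriv]
  simp only [hh]
  field_simp

/-- `(χ′/χ)(z̄) = conj (χ′/χ)(z)` off the real axis (private helper: Schwarz reflection for the
tree's `rsChi`, via `rsChi_conj`). [folklore] -/
private theorem logDeriv_rsChi_conj {w : ℂ} (hw : w.im ≠ 0) :
    logDeriv rsChi (conj w) = conj (logDeriv rsChi w) := by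
  have hw' : (conj w).im ≠ 0 := by simpa using hw
  have hev := rsChi_eventuallyEq_conj_conj hw'
  have hd : HasDerivAt (conj ∘ rsChi ∘ conj) (conj (deriv rsChi w)) (conj w) :=
    (differentiableAt_rsChi_of_im_ne_zero hw).hasDerivAt.conj_conj
  rw [logDeriv_apply, logDeriv_apply, hev.deriv_eq, hd.deriv, rsChi_conj hw, ← map_div₀]

/-- **`ϑ′/ϑ` reflected**: for `σ + it` with `t ≠ 0`,
`(ϑ′/ϑ)(σ + it) = conj (ϑ′/ϑ)((1 − σ) + it)` (`1 − (σ+it) = conj((1−σ)+it)`).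
[cite: Zhang2022LandauSiegel, §4 (4.6) p. 19] -/
theorem logDeriv_vartheta_reflect {σ t : ℝ} (ht : t ≠ 0) :
    logDeriv vartheta ((σ : ℂ) + t * I) = conj (logDeriv vartheta (((1 - σ : ℝ) : ℂ) + t * I)) := by
  have h1 : ((σ : ℂ) + t * I).im ≠ 0 := by simpa using ht
  have h2 : ((((1 - σ : ℝ) : ℂ)) + t * I).im ≠ 0 := by simpa using ht
  have hconj : (1 : ℂ) - ((σ : ℂ) + t * I) = conj (((1 - σ : ℝ) : ℂ) + t * I) := by
    apply Complex.ext <;> simp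
  rw [logDeriv_vartheta_eq h1, logDeriv_vartheta_eq h2, logDeriv_rsChi_eq_one_sub h1, hconj,
    logDeriv_rsChi_conj h2]

/-- **Stirling for `ϑ′/ϑ` on a two-sided strip**: for `1 ≤ A`, `|σ| ≤ A`, `t ≥ 2(A+1)`:
`‖(ϑ′/ϑ)(σ+it) + log(t/2π)‖ ≤ (2A+5)/t` (the tree's one-sided bound
`norm_logDeriv_vartheta_add_log_le`, reflected for `σ ≤ 0`).
[cite: Zhang2022LandauSiegel, §4 (4.6) p. 19] -/
theorem norm_logDeriv_vartheta_add_log_le_of_abs_le {A σ t : ℝ} (hA : 1 ≤ A) (hσA : |σ| ≤ A)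
    (ht : 2 * (A + 1) ≤ t) :
    ‖logDeriv vartheta ((σ : ℂ) + t * I) + Real.log (t / (2 * π))‖ ≤ (2 * A + 5) / t := by
  have hA1 : 1 ≤ A + 1 := by linarith
  obtain ⟨hσ1, hσ2⟩ := abs_le.mp hσA
  have heq : (2 * A + 5) / t = (2 * (A + 1) + 3) / t := by ring
  rw [heq]
  rcases lt_or_ge 0 σ with hσ | hσ
  · exact norm_logDeriv_vartheta_add_log_le hA1 hσ (by linarith) ht
  · have ht0 : t ≠ 0 := by linarith
    have hlog : ((Real.log (t / (2 * π)) : ℝ) : ℂ) = conj (((Real.log (t / (2 * π)) : ℝ) : ℂ)) :=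
      (Complex.conj_ofReal _).symm
    rw [logDeriv_vartheta_reflect ht0, hlog, ← map_add, Complex.norm_conj]
    exact norm_logDeriv_vartheta_add_log_le hA1 (by linarith) (by linarith) ht

variable {k : ℕ} [NeZero k]

/-- **`Z′/Z(σ+it,θ) = −log(kt/2π) + O(1/t)` on a two-sided strip**: for primitive `θ` mod `k`,
`1 ≤ A`, `|σ| ≤ A`, `t ≥ 2(A+1)`: `‖(Z′/Z)(σ+it,θ) + log(kt/2π)‖ ≤ (2A+7)/t`
(`Z′/Z = −log k + ϑ′/ϑ + E`, `|E| ≤ 2π/(e^{πt} − e^{−πt}) ≤ 2/t`).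
[cite: Zhang2022LandauSiegel, §4 (4.6) p. 19] -/
theorem norm_logDeriv_Zfac_add_log_le_of_abs_le {θ : DirichletCharacter ℂ k} (hθ : θ.IsPrimitive)
    {A σ t : ℝ} (hA : 1 ≤ A) (hσA : |σ| ≤ A) (ht : 2 * (A + 1) ≤ t) :
    ‖logDeriv (Zfac θ) ((σ : ℂ) + t * I) + Real.log ((k : ℝ) * t / (2 * π))‖ ≤ (2 * A + 7) / t := by
  have ht1 : 1 ≤ t := by linarith
  have ht0 : 0 < t := by linarith
  have hk0 : (0 : ℝ) < k := Nat.cast_pos.mpr (Nat.pos_of_ne_zero (NeZero.ne k))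
  set s : ℂ := (σ : ℂ) + t * I with hs
  have him : s.im = t := by simp [hs]
  have hpos : 0 < s.im := by rw [him]; exact ht0
  have hZ := logDeriv_Zfac_eq hθ hpos
  have hϑ := norm_logDeriv_vartheta_add_log_le_of_abs_le hA hσA ht
  have hE : ‖logDerivCorr θ s‖ ≤ 2 / t := by
    refine (norm_logDerivCorr_le θ hpos).trans ?_
    rw [him]
    exact two_pi_div_exp_sub_exp_le ht1
  have hlog : Real.log ((k : ℝ) * t / (2 * π)) = Real.log k + Real.log (t / (2 * π)) := by
    rw [mul_div_assoc, Real.log_mul hk0.ne' (by positivity)]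
  have hdecomp : logDeriv (Zfac θ) s + Real.log ((k : ℝ) * t / (2 * π))
      = (logDeriv vartheta s + Real.log (t / (2 * π))) + logDerivCorr θ s := by
    rw [hZ, hlog]
    push_cast
    ring
  calc ‖logDeriv (Zfac θ) s + Real.log ((k : ℝ) * t / (2 * π))‖
      = ‖(logDeriv vartheta s + Real.log (t / (2 * π))) + logDerivCorr θ s‖ := by rw [hdecomp]
    _ ≤ ‖logDeriv vartheta s + Real.log (t / (2 * π))‖ + ‖logDerivCorr θ s‖ := norm_add_le _ _
    _ ≤ (2 * A + 5) / t + 2 / t := add_le_add hϑ hE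
    _ = (2 * A + 7) / t := by ring

variable {k₁ k₂ : ℕ} [NeZero k₁] [NeZero k₂]

/-- **(4.6) in exact two-sided form**: for primitive `ψ` mod `k₁`, `θ₂` mod `k₂`, `1 ≤ A`,
`|σ| ≤ A`, `t ≥ 2(A+1)`:
`‖(Z̃′/Z̃)(σ+it) + log(k₁t/2π) + log(k₂t/2π)‖ ≤ 2(2A+7)/t` (the tree's
`norm_logDeriv_tildeZ_add_log_le` without the restriction `σ > 0`).
[cite: Zhang2022LandauSiegel, §4 (4.6) p. 19] -/
theorem norm_logDeriv_tildeZ_add_log_le_of_abs_le {ψ : DirichletCharacter ℂ k₁}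
    {θ₂ : DirichletCharacter ℂ k₂} (hψ : ψ.IsPrimitive) (hθ : θ₂.IsPrimitive) {A σ t : ℝ}
    (hA : 1 ≤ A) (hσA : |σ| ≤ A) (ht : 2 * (A + 1) ≤ t) :
    ‖logDeriv (tildeZ ψ θ₂) ((σ : ℂ) + t * I)
        + (((Real.log ((k₁ : ℝ) * t / (2 * π)) : ℝ) : ℂ) + ((Real.log ((k₂ : ℝ) * t / (2 * π)) : ℝ) : ℂ))‖
      ≤ 2 * ((2 * A + 7) / t) := by
  have ht0 : 0 < t := by linarith
  have hs : 0 < ((σ : ℂ) + t * I).im := by simpa using ht0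
  have h1 := norm_logDeriv_Zfac_add_log_le_of_abs_le hψ hA hσA ht
  have h2 := norm_logDeriv_Zfac_add_log_le_of_abs_le hθ hA hσA ht
  have hmul : logDeriv (tildeZ ψ θ₂) ((σ : ℂ) + t * I)
      = logDeriv (Zfac ψ) ((σ : ℂ) + t * I) + logDeriv (Zfac θ₂) ((σ : ℂ) + t * I) := by
    have hfun : tildeZ ψ θ₂ = fun s => Zfac ψ s * Zfac θ₂ s := rfl
    rw [hfun]
    exact logDeriv_mul ((σ : ℂ) + t * I) (Zfac_ne_zero hψ hs) (Zfac_ne_zero hθ hs)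
      (analyticAt_Zfac ψ hs).differentiableAt (analyticAt_Zfac θ₂ hs).differentiableAt
  rw [hmul]
  calc ‖logDeriv (Zfac ψ) ((σ : ℂ) + t * I) + logDeriv (Zfac θ₂) ((σ : ℂ) + t * I)
        + (((Real.log ((k₁ : ℝ) * t / (2 * π)) : ℝ) : ℂ) + ((Real.log ((k₂ : ℝ) * t / (2 * π)) : ℝ) : ℂ))‖
      = ‖(logDeriv (Zfac ψ) ((σ : ℂ) + t * I) + ((Real.log ((k₁ : ℝ) * t / (2 * π)) : ℝ) : ℂ))
        + (logDeriv (Zfac θ₂) ((σ : ℂ) + t * I) + ((Real.log ((k₂ : ℝ) * t / (2 * π)) : ℝ) : ℂ))‖ := by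
          ring_nf
    _ ≤ ‖logDeriv (Zfac ψ) ((σ : ℂ) + t * I) + ((Real.log ((k₁ : ℝ) * t / (2 * π)) : ℝ) : ℂ)‖
        + ‖logDeriv (Zfac θ₂) ((σ : ℂ) + t * I) + ((Real.log ((k₂ : ℝ) * t / (2 * π)) : ℝ) : ℂ)‖ :=
          norm_add_le _ _
    _ ≤ (2 * A + 7) / t + (2 * A + 7) / t := add_le_add h1 h2
    _ = 2 * ((2 * A + 7) / t) := by ring

end GammaFactor

/-! ## The bookkeeping at the manuscript's parameters and the discharge of `Eq46` -/

namespace Section4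

open Skeleton

/-- `𝓛 ≥ 32` once `D ≥ ⌈e³²⌉`. [folklore] -/
private theorem ell_ge_of_le {D : ℕ} (hD : ⌈Real.exp 32⌉₊ ≤ D) : 32 ≤ ell D := by
  have h : Real.exp 32 ≤ D := le_trans (Nat.le_ceil _) (by exact_mod_cast hD)
  exact (Real.le_log_iff_exp_le (lt_of_lt_of_le (Real.exp_pos _) h)).mpr h

/-- The modulus of a member of `Ψ` satisfies `P < p < P(1 + 𝓛⁻⁶⁸)` (§2 p. 5, "`p ∼ P`").
[cite: Zhang2022LandauSiegel, §2 (2.6) p. 5] -/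
theorem bigP_lt_p_and_lt {D : ℕ} (x : Chr D) :
    bigP D < x.p ∧ (x.p : ℝ) < bigP D * (1 + (ell D ^ 68)⁻¹) := by
  have hmem := x.mem
  rw [primeWindow, Finset.mem_filter, Finset.mem_Ioo] at hmem
  obtain ⟨⟨h1, h2⟩, -⟩ := hmem
  have hP0 : 0 ≤ bigP D := (Real.exp_pos _).le
  exact ⟨(Nat.floor_lt hP0).mp h1, Nat.lt_ceil.mp h2⟩

/-- **The parameter window of (4.6)**: for `𝓛 ≥ 32` and `s` with `|Re(s − s₀)| < 100`,
`|Im(s − s₀)| < 𝓛₁ + 3`: `|σ| ≤ 101`, `5t₀ ≤ t ≤ 8t₀` (so `t ≥ 204`), with `t₀ = 𝓛⁵¹⁹ ≥ 𝓛²`.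
[cite: Zhang2022LandauSiegel, §4 (4.6) p. 19] -/
theorem window_of_mem_Region45 {D : ℕ} (hL : 32 ≤ ell D) {s : ℂ} (hs : s ∈ Region45 D) :
    |s.re| ≤ 101 ∧ 5 * t0 D ≤ s.im ∧ s.im ≤ 8 * t0 D ∧ ell D ^ 2 ≤ t0 D := by
  obtain ⟨hre, him⟩ := hs
  have hL1 : 1 ≤ ell D := by linarith
  have hre' : (s - s0 D).re = s.re - 1 / 2 := by simp [s0, SmoothWeight.s0]
  have him' : (s - s0 D).im = s.im - 2 * π * t0 D := by simp [s0, SmoothWeight.s0]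
  rw [hre'] at hre
  rw [him'] at him
  obtain ⟨hre1, hre2⟩ := abs_lt.mp hre
  obtain ⟨him1, him2⟩ := abs_lt.mp him
  have ht0sq : ell D ^ 2 ≤ t0 D := by
    rw [t0]; exact pow_le_pow_right₀ hL1 (by norm_num)
  have h405 : ell1 D + 3 ≤ t0 D := by
    rw [ell1, t0]
    have h1 : ell D ^ 405 * 2 ≤ ell D ^ 519 := by
      calc ell D ^ 405 * 2 ≤ ell D ^ 405 * ell D ^ 114 := by
            gcongr
            calc (2 : ℝ) ≤ 32 ^ 114 := by norm_num
              _ ≤ ell D ^ 114 := pow_le_pow_left₀ (by norm_num) hL 114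
        _ = ell D ^ 519 := by rw [← pow_add]
    have h3 : (3 : ℝ) ≤ ell D ^ 405 := le_trans (by norm_num : (3:ℝ) ≤ 32)
      (le_trans hL (le_self_pow₀ hL1 (by norm_num)))
    linarith
  have hπ1 : 3 < π := Real.pi_gt_three
  have hπ2 : π < 3.15 := Real.pi_lt_d2
  have ht0pos : 0 ≤ t0 D := le_trans (sq_nonneg _) ht0sq
  refine ⟨?_, ?_, ?_, ht0sq⟩
  · rw [abs_le]; constructor <;> linarith
  · nlinarith
  · nlinarith

/-- **The logarithmic bookkeeping of (4.6)**: for `𝓛 ≥ 32`, `ψ ∈ Ψ` (modulus `p`), and `t` with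
`5t₀ ≤ t ≤ 8t₀`: `0 ≤ log(pt/2π) + log(Dpt/2π) − 2 log P ≤ 1046·𝓛`
(`log p − log P ∈ (0, log 2)`, `log D = 𝓛`, `0 ≤ log(t/2π) ≤ log 2 + 519 log 𝓛`).
[cite: Zhang2022LandauSiegel, §4 (4.6) p. 19] -/
theorem log_bookkeeping {D : ℕ} [NeZero D] (hL : 32 ≤ ell D) (x : Chr D) {t : ℝ}
    (ht1 : 5 * t0 D ≤ t) (ht2 : t ≤ 8 * t0 D) (ht0 : ell D ^ 2 ≤ t0 D) :
    0 ≤ Real.log ((x.p : ℝ) * t / (2 * π)) + Real.log (((D * x.p : ℕ) : ℝ) * t / (2 * π))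
        - 2 * Real.log (bigP D) ∧
      Real.log ((x.p : ℝ) * t / (2 * π)) + Real.log (((D * x.p : ℕ) : ℝ) * t / (2 * π))
        - 2 * Real.log (bigP D) ≤ 1046 * ell D := by
  have hL1 : 1 ≤ ell D := by linarith
  have hπ1 : 3 < π := Real.pi_gt_three
  have hπ2 : π < 4 := Real.pi_lt_four
  obtain ⟨hPp, hpP⟩ := bigP_lt_p_and_lt x
  have hP0 : 0 < bigP D := Real.exp_pos _
  have hp0 : (0 : ℝ) < x.p := hP0.trans hPp
  have hD1 : (1 : ℝ) < D := by
    have : 0 < ell D := by linarith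
    rw [ell] at this
    have hD0 : (0 : ℝ) < D := by
      rcases Nat.eq_zero_or_pos D with h | h
      · exfalso; subst h; simp at this
      · exact_mod_cast h
    exact (Real.log_pos_iff hD0.le).mp this
  have hD0 : (0 : ℝ) < D := by linarith
  have ht0' : 0 < t0 D := lt_of_lt_of_le (by positivity) ht0
  have htpos : 0 < t := by linarith
  have hu0 : 0 < t / (2 * π) := by positivity
  -- `log p − log P ∈ [0, log 2]`
  have hp2 : (x.p : ℝ) ≤ 2 * bigP D := by
    have : (ell D ^ 68)⁻¹ ≤ 1 := inv_le_one_of_one_le₀ (one_le_pow₀ hL1)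
    nlinarith
  have hlogp1 : Real.log (bigP D) ≤ Real.log x.p := Real.log_le_log hP0 hPp.le
  have hlogp2 : Real.log x.p ≤ Real.log 2 + Real.log (bigP D) := by
    rw [← Real.log_mul (by norm_num) hP0.ne']; exact Real.log_le_log hp0 hp2
  -- `log(t/2π) ∈ [0, log 2 + 519 log 𝓛]`
  have hu1 : 1 ≤ t / (2 * π) := by
    rw [le_div_iff₀ (by positivity)]
    have : (32 : ℝ) ^ 2 ≤ t0 D := le_trans (pow_le_pow_left₀ (by norm_num) hL 2) ht0
    nlinarith
  have hlogu0 : 0 ≤ Real.log (t / (2 * π)) := Real.log_nonneg hu1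
  have hu2 : t / (2 * π) ≤ 2 * t0 D := by
    rw [div_le_iff₀ (by positivity)]; nlinarith
  have hlogt0 : Real.log (t0 D) = 519 * Real.log (ell D) := by rw [t0, Real.log_pow]; norm_num
  have hlogu2 : Real.log (t / (2 * π)) ≤ Real.log 2 + 519 * Real.log (ell D) := by
    rw [← hlogt0, ← Real.log_mul (by norm_num) ht0'.ne']
    exact Real.log_le_log hu0 hu2
  have hlogL : Real.log (ell D) ≤ ell D := (Real.log_le_sub_one_of_pos (by linarith)).trans (by linarith)
  have hlog2 : Real.log 2 ≤ 1 := by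
    have := Real.log_two_lt_d9; linarith
  -- expand the two logarithms
  have hcast : (((D * x.p : ℕ) : ℝ)) = (D : ℝ) * x.p := by push_cast; ring
  have e1 : Real.log ((x.p : ℝ) * t / (2 * π)) = Real.log x.p + Real.log (t / (2 * π)) := by
    rw [mul_div_assoc, Real.log_mul hp0.ne' hu0.ne']
  have e2 : Real.log (((D * x.p : ℕ) : ℝ) * t / (2 * π)) =
      ell D + Real.log x.p + Real.log (t / (2 * π)) := by
    rw [hcast, mul_div_assoc, Real.log_mul (by positivity) hu0.ne', Real.log_mul hD0.ne' hp0.ne', ell]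
  rw [e1, e2]
  constructor
  · nlinarith
  · nlinarith

/-- **`Section4.Eq46` holds** — (4.6) on the full printed range, constant `C = 1047`:
eventually (`𝓛 ≥ 32`), for every `ψ ∈ Ψ` and every `s` with `|Re(s − s₀)| < 100`,
`|Im(s − s₀)| < 𝓛₁ + 3`, `‖(Z̃′/Z̃)(s,ψ) + 2 log P‖ ≤ 1047·𝓛`.
[cite: Zhang2022LandauSiegel, §4 (4.6) p. 19] -/
theorem eq46_holds : Eq46 := by
  refine ⟨1047, ⌈Real.exp 32⌉₊, fun D _ χ hD hq hp x s hs => ?_⟩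
  have hL : 32 ≤ ell D := ell_ge_of_le hD
  have hL1 : 1 ≤ ell D := by linarith
  have hD3 : 3 ≤ D := by
    by_contra h
    push Not at h
    have : (D : ℝ) ≤ 2 := by exact_mod_cast Nat.lt_succ_iff.mp h
    have h2 : ell D ≤ Real.log 2 := by
      rw [ell]
      rcases Nat.eq_zero_or_pos D with h0 | h0
      · subst h0; simp; exact Real.log_nonneg (by norm_num)
      · exact Real.log_le_log (by exact_mod_cast h0) this
    have := Real.log_two_lt_d9
    linarith
  obtain ⟨hσ, ht1, ht2, ht0⟩ := window_of_mem_Region45 hL hs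
  have ht0' : (32 : ℝ) ^ 2 ≤ t0 D := le_trans (pow_le_pow_left₀ (by norm_num) hL 2) ht0
  have ht204 : 2 * ((101 : ℝ) + 1) ≤ s.im := by nlinarith
  have htpos : 0 < s.im := by linarith
  -- the exact two-sided Stirling bound at `s = σ + it`
  have hprim : (psiChi χ x).IsPrimitive := psiChiPrimitive_holds D χ x hD3 hp
  have key := GammaFactor.norm_logDeriv_tildeZ_add_log_le_of_abs_le x.prim hprim
    (A := 101) (σ := s.re) (t := s.im) (by norm_num) hσ ht204
  rw [Complex.re_add_im] at key
  -- the bookkeeping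
  obtain ⟨hE0, hE1⟩ := log_bookkeeping hL x ht1 ht2 ht0
  set E : ℝ := Real.log ((x.p : ℝ) * s.im / (2 * π)) +
    Real.log (((D * x.p : ℕ) : ℝ) * s.im / (2 * π)) - 2 * Real.log (bigP D) with hEdef
  have hfun : deriv (tildeZW χ x) s / tildeZW χ x s =
      logDeriv (GammaFactor.tildeZ x.ψ (psiChi χ x)) s := rfl
  have hsplit : deriv (tildeZW χ x) s / tildeZW χ x s + 2 * Real.log (bigP D) =
      (logDeriv (GammaFactor.tildeZ x.ψ (psiChi χ x)) s +
        (((Real.log ((x.p : ℝ) * s.im / (2 * π)) : ℝ) : ℂ) +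
          ((Real.log (((D * x.p : ℕ) : ℝ) * s.im / (2 * π)) : ℝ) : ℂ))) - (E : ℂ) := by
    rw [hfun, hEdef]
    push_cast
    ring
  have hfirst : 2 * ((2 * (101 : ℝ) + 7) / s.im) ≤ ell D := by
    rw [show 2 * ((2 * (101 : ℝ) + 7) / s.im) = 418 / s.im by ring, div_le_iff₀ htpos]
    nlinarith
  calc ‖deriv (tildeZW χ x) s / tildeZW χ x s + 2 * Real.log (bigP D)‖
      = ‖(logDeriv (GammaFactor.tildeZ x.ψ (psiChi χ x)) s +
          (((Real.log ((x.p : ℝ) * s.im / (2 * π)) : ℝ) : ℂ) +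
            ((Real.log (((D * x.p : ℕ) : ℝ) * s.im / (2 * π)) : ℝ) : ℂ))) - (E : ℂ)‖ := by rw [hsplit]
    _ ≤ ‖logDeriv (GammaFactor.tildeZ x.ψ (psiChi χ x)) s +
          (((Real.log ((x.p : ℝ) * s.im / (2 * π)) : ℝ) : ℂ) +
            ((Real.log (((D * x.p : ℕ) : ℝ) * s.im / (2 * π)) : ℝ) : ℂ))‖ + ‖(E : ℂ)‖ :=
        norm_sub_le _ _
    _ ≤ 2 * ((2 * (101 : ℝ) + 7) / s.im) + 1046 * ell D := by
        refine add_le_add key ?_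
        rw [Complex.norm_real, Real.norm_eq_abs, abs_of_nonneg hE0]
        exact hE1
    _ ≤ ell D + 1046 * ell D := by linarith
    _ = 1047 * ell D := by ring

end Section4

namespace Typed.Section04A

open Skeleton

/-- **`Typed.Section04A.Eq46` holds** (the supplementary typed form of (4.6), `logDeriv` spelling;
same statement as `Section4.Eq46` — `InRange45` and `Region45` are the same range).
[cite: Zhang2022LandauSiegel, §4 (4.6) p. 19] -/
theorem eq46_holds : Eq46 := by
  obtain ⟨C, D₀, h⟩ := Section4.eq46_holds
  exact ⟨C, D₀, fun D _ χ hD hq hp x s hs => h D χ hD hq hp x s hs⟩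

end Typed.Section04A

end Literature.NumberTheory.LFunctions.Zhang2022
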